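import Mathlib

/-!
# OverbindingBudget / affine run cut — discrete crossing kernel («D1-SHEET», ORDER (2c))

Helper lemmas (pure real / inner-product geometry, Mathlib only) for the DISCRETE crossing-exclusion step of the re-cut
(D1) development of leaf SW♭ (`…OverbindingBudgetAffineRunCutFlat.StackSwapGainFlatWide`, crux
`RobustDefectLimitWindows`, stmt-AtomisticToContinuum-31280); memo SW-CHI §10.9 (lens-4 g87).

The geometric situation: `Π₁` is a certified flat complete layer (sites within `s` of a plane with unit normal `n`
through `q`), `Σ₂` a complete foreign sheet given as a CHAIN of sites `p 0, p 1, …, p k` whose consecutive signed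
heights over the plane differ by at most `L` (basal contact steps), starting below and ending above the plane.  Then
some chain site lies within `L/2` of the plane (`exists_chain_site_near_plane`, a discrete intermediate-value step), and
a point at height `≤ a` whose foot is within lateral distance `b` of a layer site is within `√(a² + b²)`-type distance of
that site (`norm_sq_eq_height_sq_add_lateral_sq`, `dist_le_of_height_of_lateral`).  With `L = 1ν`, `s = 0.37ν`, covering
radius `0.58ν` this puts a `Σ₂`-site within `1.05ν` of a `Π₁`-site, which the local crossing-exclusion fact forbids.

[this file: 0 definitions, 6 theorems; imports Mathlib only; standard axioms]
-/

namespace Summit.AtomisticToContinuum.Crystallization.Theorems.OverbindingBudgetAffineRunCutSheetCross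

open scoped InnerProductSpace

/-- Discrete intermediate value step on `ℕ`: a real sequence that starts negative and is nonnegative at `k` changes
sign between two consecutive indices below `k`.  (A cousin with the opposite orientation and an interval `[a, b)`,
`…HullExactificationCascadeZeroDefectDensityCensusCertTri.exists_sign_change`, exists in a heavy sibling file; this
Mathlib-only variant is stated in the form the chain lemma below consumes.) [this file] -/
theorem exists_index_sign_change_below (f : ℕ → ℝ) (k : ℕ) (h0 : f 0 < 0) (hk : 0 ≤ f k) :
    ∃ i < k, f i < 0 ∧ 0 ≤ f (i + 1) := by
  induction k with
  | zero => exact absurd hk (not_le.mpr h0)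
  | succ k ih =>
      by_cases hk' : 0 ≤ f k
      · obtain ⟨i, hi, h1, h2⟩ := ih hk'
        exact ⟨i, Nat.lt_succ_of_lt hi, h1, h2⟩
      · exact ⟨k, Nat.lt_succ_self k, not_le.mp hk', hk⟩

/-- At a sign change with step at most `L`, one of the two values is within `L/2` of zero. [this file] -/
theorem min_abs_le_half_of_sign_change {a b L : ℝ} (ha : a ≤ 0) (hb : 0 ≤ b) (hL : b - a ≤ L) :
    |a| ≤ L / 2 ∨ |b| ≤ L / 2 := by
  by_cases h : -a ≤ b
  · left; rw [abs_of_nonpos ha]; linarith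
  · right; rw [abs_of_nonneg hb]; rw [not_le] at h; linarith

/-- ★ DISCRETE IVT FOR A CHAIN OVER A PLANE.  Sites `p 0, …, p k` with signed heights `⟪n, p i - q⟫` over the plane
`{z | ⟪n, z - q⟫ = 0}`; consecutive heights differ by at most `L`; `p 0` strictly below, `p k` on or above.  Then some
chain site with index `≤ k` has |height| ≤ `L/2`. [this file] -/
theorem exists_chain_site_near_plane {V : Type*} [NormedAddCommGroup V] [InnerProductSpace ℝ V]
    (n q : V) (p : ℕ → V) (k : ℕ) (L : ℝ)
    (hstep : ∀ i < k, |⟪n, p (i + 1) - q⟫_ℝ - ⟪n, p i - q⟫_ℝ| ≤ L)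
    (h0 : ⟪n, p 0 - q⟫_ℝ < 0) (hk : 0 ≤ ⟪n, p k - q⟫_ℝ) :
    ∃ i ≤ k, |⟪n, p i - q⟫_ℝ| ≤ L / 2 := by
  obtain ⟨i, hi, h1, h2⟩ := exists_index_sign_change_below (fun i => ⟪n, p i - q⟫_ℝ) k h0 hk
  have hs := hstep i hi
  rcases min_abs_le_half_of_sign_change h1.le h2 (le_trans (le_abs_self _) hs) with h | h
  · exact ⟨i, hi.le, h⟩
  · exact ⟨i + 1, hi, h⟩

/-- Height–lateral decomposition along a unit vector: `‖v‖² = ⟪n, v⟫² + ‖v - ⟪n, v⟫ • n‖²`. [this file] -/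
theorem norm_sq_eq_height_sq_add_lateral_sq {V : Type*} [NormedAddCommGroup V] [InnerProductSpace ℝ V]
    {n : V} (hn : ‖n‖ = 1) (v : V) :
    ‖v‖ ^ 2 = ⟪n, v⟫_ℝ ^ 2 + ‖v - ⟪n, v⟫_ℝ • n‖ ^ 2 := by
  have hnn : ⟪n, n⟫_ℝ = 1 := by
    rw [real_inner_self_eq_norm_sq, hn]; norm_num
  have h1 : ‖v - ⟪n, v⟫_ℝ • n‖ ^ 2 = ‖v‖ ^ 2 - ⟪n, v⟫_ℝ ^ 2 := by
    rw [← real_inner_self_eq_norm_sq, ← real_inner_self_eq_norm_sq (x := v)]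
    simp only [inner_sub_left, inner_sub_right, real_inner_smul_left, real_inner_smul_right, hnn, real_inner_comm n v]
    ring
  linarith

/-- ★ A point `x` at |height| ≤ `a` over the plane through `q` with unit normal `n`, and a site `m` of the layer at
|height| ≤ `s`, whose lateral (in-plane) separation is at most `b`: `‖(x - m) - ⟪n, x - m⟫ • n‖ ≤ b`.  Then
`‖x - m‖² ≤ (a + s)² + b²`. [this file] -/
theorem dist_sq_le_of_height_of_lateral {V : Type*} [NormedAddCommGroup V] [InnerProductSpace ℝ V]
    {n q x m : V} {a s b : ℝ} (hn : ‖n‖ = 1)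
    (hx : |⟪n, x - q⟫_ℝ| ≤ a) (hm : |⟪n, m - q⟫_ℝ| ≤ s)
    (hb : ‖(x - m) - ⟪n, x - m⟫_ℝ • n‖ ≤ b) :
    ‖x - m‖ ^ 2 ≤ (a + s) ^ 2 + b ^ 2 := by
  have hdec := norm_sq_eq_height_sq_add_lateral_sq hn (x - m)
  have hh : ⟪n, x - m⟫_ℝ = ⟪n, x - q⟫_ℝ - ⟪n, m - q⟫_ℝ := by
    rw [← inner_sub_right]; congr 1; abel
  have habs : |⟪n, x - m⟫_ℝ| ≤ a + s := by
    rw [hh]; exact le_trans (abs_sub _ _) (add_le_add hx hm)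
  have ha0 : 0 ≤ a + s := le_trans (abs_nonneg _) habs
  have hb0 : 0 ≤ b := le_trans (norm_nonneg _) hb
  have h1 : ⟪n, x - m⟫_ℝ ^ 2 ≤ (a + s) ^ 2 := by
    rw [← sq_abs]; exact pow_le_pow_left₀ (abs_nonneg _) habs 2
  have h2 : ‖(x - m) - ⟪n, x - m⟫_ℝ • n‖ ^ 2 ≤ b ^ 2 := pow_le_pow_left₀ (norm_nonneg _) hb 2
  linarith

/-- ★ The numerical instance used by «D1-SHEET»: step `L = 1` (so |height of the chain site| ≤ 1/2), layer flatness
`s = 37/100`, covering radius `b = 58/100` (in units of the spacing): the foreign-sheet site is within `21/20 = 1.05`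
of a layer site (`(1/2 + 37/100)² + (58/100)² = 1.0933 ≤ 1.1025 = 1.05²`). [this file] -/
theorem dist_le_of_height_of_lateral_inst {V : Type*} [NormedAddCommGroup V] [InnerProductSpace ℝ V]
    {n q x m : V} (hn : ‖n‖ = 1)
    (hx : |⟪n, x - q⟫_ℝ| ≤ 1 / 2) (hm : |⟪n, m - q⟫_ℝ| ≤ 37 / 100)
    (hb : ‖(x - m) - ⟪n, x - m⟫_ℝ • n‖ ≤ 58 / 100) :
    dist x m ≤ 21 / 20 := by
  have h := dist_sq_le_of_height_of_lateral hn hx hm hb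
  rw [dist_eq_norm]
  have h2 : ‖x - m‖ ^ 2 ≤ (21 / 20) ^ 2 := le_trans h (by norm_num)
  exact (abs_le_of_sq_le_sq' h2 (by norm_num)).2

end Summit.AtomisticToContinuum.Crystallization.Theorems.OverbindingBudgetAffineRunCutSheetCross
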